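import Literature.Barriers.AtomisticToContinuum.DisorderedHarmonicChainPosDef
import Literature.Barriers.AtomisticToContinuum.DisorderedHarmonicChainGenerator
import Literature.MathematicalPhysics.KineticTheory.LinearLangevinGaussianMeasure
import Mathlib.Analysis.Calculus.FDeriv.Symmetric
import HarnessLib

/-!
# The Gaussian stationary state of the Casher–Lebowitz chain (discharge of `CasherLebowitz1971_steadyState`)

Barrier catalogue `Literature/Barriers/AtomisticToContinuum/`, sub-problem `FouriersLaw`; provefact
unit of the named fact `CasherLebowitz1971_steadyState` = (F1a) of
`DisorderedHarmonicChainSpectral.lean` (the decomposition of `AjankiHuveneers2011_scaling`). This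
file PROVES (F1a): for every `n`, positive masses `m`, friction `λ > 0` and bath temperatures
`T_L, T_R > 0`, the centred Gaussian probability measure `gaussMeasure B⁻¹ = Z⁻¹ e^{-½ x♭ᵀB⁻¹x♭} dq dp`
(`LinearLangevinGaussianMeasure.lean`) with covariance `B = clCov m λ T_L T_R` — the solution of
the Lyapunov equation "`â·B̂ + B̂·âᵀ = D̂`" — is a weak steady state of `clGenerator`
(`clIsSteadyState`: `∫ L f dμ = 0` for `f ∈ C_c^∞`, `p_k²` integrable) with second moments
`∫ x_i x_j dμ = B_ij`: `theorem CasherLebowitz1971_steadyState_holds`.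

## Source

A. Dhar, *Heat transport in low-dimensional systems*, Adv. Phys. 57 (2008) 457–537
(arXiv:0808.3256), §3.1 "The Rieder-Lebowitz-Lieb method" (pp. 10–11), for arbitrary masses
and couplings: "`q̇ = -â q + η` … In the steady state … `â·B̂ + B̂·âᵀ = D̂`. The solution of
this equation gives the steady state correlation matrix `B̂` which completely determines the
steady state since we are dealing with a Gaussian process. In fact the steady state is given by
the Gaussian distribution `P({q_l}) = (2π)^{-N} Det[B̂]^{-1/2} e^{-½ qᵀ B̂⁻¹ q}`." The proof is
the standard weak verification of the stationary Fokker–Planck equation, organised through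
Gaussian integration by parts (Stein's identity); it uses no stability of the drift.

## Proof architecture (all proved; ingredients from the tree)

* `clCov_posDef` (`DisorderedHarmonicChainPosDef.lean`): `B ≻ 0`, so `gaussMeasure B⁻¹` is a
  probability measure with covariance `B` (`isProbabilityMeasure_gaussMeasure`,
  `integral_flat_mul_flat_gaussMeasure` of `LinearLangevinGaussianMeasure.lean`).
* GENERIC PART (any drift `A`, diffusion `D`, covariance `S ≻ 0` with `A S + S Aᵀ + D = 0`):
  the coordinate partial derivatives `∂♭ a = Sum.elim partialQ partialP a` (line derivatives
  along `coordVec a`), their regularity and the symmetry of mixed partials (`flatDeriv_comm`,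
  Schwarz); Stein's identity `∫ (C x♭)_a h ρ_C = ∫ ∂_a h ρ_C` (`h ∈ C¹_c`, one integration by
  parts through the wrapper `integral_mul_eq_neg_of_hasLineDerivAt` of `LangevinChainGibbs.lean`)
  and its covariance form `∫ x♭_c h ρ_{S⁻¹} = ∑_a S_ca ∫ ∂_a h ρ_{S⁻¹}`; whence
  `integral_ouGenerator_mul_gaussDensity`:
  `∫ (∑_a (A x♭)_a ∂_a f + ½ ∑_{ab} D_ab ∂_a∂_b f) ρ_{S⁻¹} = 0` for `f ∈ C²_c` (the drift term is
  `∑ (AS)_ab ∫ ∂_b∂_a f ρ`, the diffusion term `½∑ D_ab ∫ ∂_a∂_b f ρ`, and the Lyapunov equation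
  with the symmetry of the Hessian closes it).
* CHAIN PART: the pointwise identity `clGenerator_eq_ouGenerator` — the Casher–Lebowitz generator
  is the Ornstein–Uhlenbeck generator of `A = clDriftMatrix m λ`, `D = clNoiseMatrix m λ T_L T_R`
  (`partialQ_clHamiltonian` of `DisorderedHarmonicChainGenerator.lean`) — and the Lyapunov equation
  `clCov_lyapunov` of `DisorderedHarmonicChainSpectral.lean`.

## Design notes

* The Ornstein–Uhlenbeck generator is written out (`∑_a (A x♭)_a ∂♭_a f + ½ ∑ D_ab ∂♭_a ∂♭_b f`)
  rather than named, and the coordinate partials `∂♭ a` are written `Sum.elim partialQ partialP a`,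
  so that this file introduces no definitions or notation. An alternative route through the pointwise adjoint polynomial
  `clAdjointPoly` (`DisorderedHarmonicChainGenerator.lean`) would require the matrix identity
  `L*_{B⁻¹} ≡ 0`; the Stein route needs only the Lyapunov equation entrywise.
* Not here: uniqueness of the weak steady state; Gaussianity as a measure-level statement beyond
  the explicit density.
-/

noncomputable section

open MeasureTheory Matrix Filter Topology
open scoped ContDiff

namespace Literature.Barriers.AtomisticToContinuum.HeatConduction

open Literature.MathematicalPhysics.KineticTheory.HeatConduction

section Generic

variable {N : ℕ}

/-! ### Coordinate partial derivatives indexed by `Fin N ⊕ Fin N` -/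

/-- `∂_{inl i} = ∂_{q_i}`. [folklore] -/
theorem flatDeriv_inl (i : Fin N) (f : PhaseSpace N → ℝ) :
    Sum.elim partialQ partialP (Sum.inl i) f = partialQ i f := rfl

/-- `∂_{inr i} = ∂_{p_i}`. [folklore] -/
theorem flatDeriv_inr (i : Fin N) (f : PhaseSpace N → ℝ) :
    Sum.elim partialQ partialP (Sum.inr i) f = partialP i f := rfl

/-- The coordinate partial derivatives are Mathlib line derivatives along the coordinate
directions (for every `f`, with the same junk value). [folklore] -/
theorem flatDeriv_eq_lineDeriv (a : Fin N ⊕ Fin N) (f : PhaseSpace N → ℝ) (x : PhaseSpace N) :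
    Sum.elim partialQ partialP a f x = lineDeriv ℝ f x (coordVec a) := by
  rcases a with i | i
  · exact partialQ_eq_lineDeriv i f x
  · exact partialP_eq_lineDeriv i f x

/-- For differentiable `f`, `∂_a f = Df · E_a`. [folklore] -/
theorem flatDeriv_eq_fderiv {f : PhaseSpace N → ℝ} (hf : Differentiable ℝ f) (a : Fin N ⊕ Fin N) :
    Sum.elim partialQ partialP a f = fun x => fderiv ℝ f x (coordVec a) := by
  funext x
  rw [flatDeriv_eq_lineDeriv, (hf x).lineDeriv_eq_fderiv]

/-- For differentiable `f`, `∂_a f` is the line derivative along `E_a`. [folklore] -/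
theorem hasLineDerivAt_flatDeriv {f : PhaseSpace N → ℝ} (hf : Differentiable ℝ f)
    (a : Fin N ⊕ Fin N) (x : PhaseSpace N) :
    HasLineDerivAt ℝ f (Sum.elim partialQ partialP a f x) x (coordVec a) := by
  rw [flatDeriv_eq_lineDeriv]
  exact (hf x).lineDifferentiableAt.hasLineDerivAt

/-- For `f ∈ C¹`, `∂_a f` is continuous. [folklore] -/
theorem continuous_flatDeriv {f : PhaseSpace N → ℝ} {n : WithTop ℕ∞} (hf : ContDiff ℝ n f)
    (hn : n ≠ 0) (a : Fin N ⊕ Fin N) : Continuous (Sum.elim partialQ partialP a f) := by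
  rw [flatDeriv_eq_fderiv (hf.differentiable hn)]
  exact (hf.continuous_fderiv hn).clm_apply continuous_const

/-- For `f ∈ C^{m+1}`, `∂_a f ∈ C^m`. [folklore] -/
theorem contDiff_flatDeriv {f : PhaseSpace N → ℝ} {m n : WithTop ℕ∞} (hf : ContDiff ℝ n f)
    (hmn : m + 1 ≤ n) (a : Fin N ⊕ Fin N) : ContDiff ℝ m (Sum.elim partialQ partialP a f) := by
  have hn : n ≠ 0 := by
    rintro rfl
    exact absurd hmn (by simp)
  rw [flatDeriv_eq_fderiv (hf.differentiable hn)]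
  exact (hf.fderiv_right hmn).clm_apply contDiff_const

/-- `∂_a f` has compact support if `f` has. [folklore] -/
theorem hasCompactSupport_flatDeriv {f : PhaseSpace N → ℝ} (hf : Differentiable ℝ f)
    (hfc : HasCompactSupport f) (a : Fin N ⊕ Fin N) : HasCompactSupport (Sum.elim partialQ partialP a f) := by
  rw [flatDeriv_eq_fderiv hf]
  exact hfc.fderiv_apply ℝ (coordVec a)

/-- **Symmetry of the mixed partials** `∂_a ∂_b f = ∂_b ∂_a f` for `f ∈ C²` (Schwarz; Mathlib's
`ContDiffAt.isSymmSndFDerivAt`). [folklore] -/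
theorem flatDeriv_comm {f : PhaseSpace N → ℝ} (hf : ContDiff ℝ 2 f) (a b : Fin N ⊕ Fin N)
    (x : PhaseSpace N) :
    Sum.elim partialQ partialP a (Sum.elim partialQ partialP b f) x = Sum.elim partialQ partialP b (Sum.elim partialQ partialP a f) x := by
  have hd : Differentiable ℝ f := hf.differentiable two_ne_zero
  have hd' : ∀ c, Differentiable ℝ (Sum.elim partialQ partialP c f) := fun c =>
    (contDiff_flatDeriv hf (m := 1) (by norm_num) c).differentiable one_ne_zero
  have key : ∀ c d, Sum.elim partialQ partialP c (Sum.elim partialQ partialP d f) x =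
      fderiv ℝ (fderiv ℝ f) x (coordVec c) (coordVec d) := by
    intro c d
    rw [flatDeriv_eq_fderiv (hd' d) c]
    simp only
    rw [flatDeriv_eq_fderiv hd d]
    have hdf : DifferentiableAt ℝ (fderiv ℝ f) x :=
      (hf.fderiv_right (m := 1) (by norm_num)).differentiable one_ne_zero x
    rw [fderiv_clm_apply hdf (differentiableAt_const _)]
    simp
  rw [key, key]
  have hsymm : IsSymmSndFDerivAt ℝ f x := by
    refine (hf.contDiffAt).isSymmSndFDerivAt ?_
    simp
  exact hsymm (coordVec a) (coordVec b)

/-! ### Integration by parts against the Gaussian density (Stein's identity) -/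

/-- **Stein's identity, precision form.** For `h ∈ C¹_c` and symmetric `C`:
`∫ (C x♭)_a h ρ_C = ∫ (∂_a h) ρ_C` (one integration by parts, `∂_a ρ_C = -(Cx♭)_a ρ_C`).
[folklore] -/
theorem integral_mulVec_mul_gaussDensity {C : Matrix (Fin N ⊕ Fin N) (Fin N ⊕ Fin N) ℝ}
    (hC : Cᵀ = C) {h : PhaseSpace N → ℝ} (hh : ContDiff ℝ 1 h) (hhc : HasCompactSupport h)
    (a : Fin N ⊕ Fin N) :
    ∫ x, (C *ᵥ flat x) a * h x * gaussDensity C x = ∫ x, Sum.elim partialQ partialP a h x * gaussDensity C x := by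
  have hhd : Differentiable ℝ h := hh.differentiable one_ne_zero
  have e := integral_mul_eq_neg_of_hasLineDerivAt (v := (coordVec a : PhaseSpace N))
    (F := gaussDensity C) (F' := fun x => -((C *ᵥ flat x) a) * gaussDensity C x)
    (g := h) (g' := Sum.elim partialQ partialP a h) (continuous_gaussDensity C)
    ((continuous_mulVec_flat_apply C a).neg.mul (continuous_gaussDensity C)) hh.continuous
    (continuous_flatDeriv hh one_ne_zero a) hhc (hasCompactSupport_flatDeriv hhd hhc a)
    (fun x => hasLineDerivAt_gaussDensity_coordVec C hC x a)
    (fun x => hasLineDerivAt_flatDeriv hhd a x)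
  rw [← integral_neg] at e
  calc ∫ x, (C *ᵥ flat x) a * h x * gaussDensity C x
      = ∫ x, -((-((C *ᵥ flat x) a) * gaussDensity C x) * h x) := by
        congr 1; funext x; ring
    _ = ∫ x, gaussDensity C x * Sum.elim partialQ partialP a h x := e.symm
    _ = ∫ x, Sum.elim partialQ partialP a h x * gaussDensity C x := by
        congr 1; funext x; ring

/-- **Stein's identity, covariance form.** For `S` positive definite and `h ∈ C¹_c`:
`∫ x♭_c h ρ_{S⁻¹} = ∑_a S_ca ∫ (∂_a h) ρ_{S⁻¹}`. [folklore] -/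
theorem integral_flat_mul_gaussDensity_eq_sum {S : Matrix (Fin N ⊕ Fin N) (Fin N ⊕ Fin N) ℝ}
    (hS : S.PosDef) {h : PhaseSpace N → ℝ} (hh : ContDiff ℝ 1 h) (hhc : HasCompactSupport h)
    (c : Fin N ⊕ Fin N) :
    ∫ x, flat x c * h x * gaussDensity S⁻¹ x =
      ∑ a, S c a * ∫ x, Sum.elim partialQ partialP a h x * gaussDensity S⁻¹ x := by
  have hC : (S⁻¹)ᵀ = S⁻¹ := transpose_eq_of_posDef hS.inv
  have hunit : IsUnit S.det := (isUnit_iff_isUnit_det _).mp hS.isUnit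
  have hX : ∀ x : PhaseSpace N, flat x c = ∑ a, S c a * (S⁻¹ *ᵥ flat x) a := by
    intro x
    have h1 : (S * S⁻¹) *ᵥ flat x = flat x := by rw [mul_nonsing_inv _ hunit, one_mulVec]
    have h2 := congrFun h1 c
    rw [← mulVec_mulVec] at h2
    rw [← h2]
    simp only [mulVec, dotProduct]
  have hint : ∀ a, Integrable fun x : PhaseSpace N =>
      (S⁻¹ *ᵥ flat x) a * h x * gaussDensity S⁻¹ x := by
    intro a
    refine Continuous.integrable_of_hasCompactSupport
      (((continuous_mulVec_flat_apply S⁻¹ a).mul hh.continuous).mul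
        (continuous_gaussDensity S⁻¹)) ?_
    exact (hhc.mul_left).mul_right
  calc ∫ x, flat x c * h x * gaussDensity S⁻¹ x
      = ∫ x, ∑ a, S c a * ((S⁻¹ *ᵥ flat x) a * h x * gaussDensity S⁻¹ x) := by
        congr 1; funext x
        rw [hX x]
        simp only [Finset.sum_mul]
        refine Finset.sum_congr rfl fun a _ => ?_
        ring
    _ = ∑ a, S c a * ∫ x, (S⁻¹ *ᵥ flat x) a * h x * gaussDensity S⁻¹ x := by
        rw [integral_finsetSum _ fun a _ => (hint a).const_mul _]
        congr 1; funext a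
        rw [integral_const_mul]
    _ = ∑ a, S c a * ∫ x, Sum.elim partialQ partialP a h x * gaussDensity S⁻¹ x := by
        congr 1; funext a
        rw [integral_mulVec_mul_gaussDensity hC hh hhc a]

/-! ### The generator in matrix form and its Gaussian stationary state -/

/-- **Weak stationarity of the Gaussian with Lyapunov covariance.** If `S` is positive definite
and solves the Lyapunov equation `A S + S Aᵀ + D = 0`, then `∫ (L_{A,D} f) ρ_{S⁻¹} = 0` for every
`f ∈ C²_c`: by Stein's identity the drift term is `∑_{ab} (AS)_ab ∫ ∂_b∂_a f ρ`, the diffusion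
term is `½ ∑ D_ab ∫ ∂_a∂_b f ρ`, and the mixed partials are symmetric ("`â·B̂ + B̂·âᵀ = D̂` … the
steady state is given by the Gaussian distribution"). [cite: Dhar2008, §3.1] -/
theorem integral_ouGenerator_mul_gaussDensity {A D S : Matrix (Fin N ⊕ Fin N) (Fin N ⊕ Fin N) ℝ}
    (hS : S.PosDef) (hlyap : A * S + S * Aᵀ + D = 0) {f : PhaseSpace N → ℝ}
    (hf : ContDiff ℝ 2 f) (hfc : HasCompactSupport f) :
    ∫ x, ((∑ a, (A *ᵥ flat x) a * Sum.elim partialQ partialP a f x) +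
      (1 / 2) * ∑ a, ∑ b, D a b * Sum.elim partialQ partialP a (Sum.elim partialQ partialP b f) x) * gaussDensity S⁻¹ x = 0 := by
  have hST : ∀ a b, S b a = S a b := fun a b => by
    have := hS.isHermitian
    rw [Matrix.IsHermitian, conjTranspose_eq_transpose_of_trivial] at this
    exact (congrFun (congrFun this a) b)
  have hfd : Differentiable ℝ f := hf.differentiable two_ne_zero
  have h1 : ∀ b, ContDiff ℝ 1 (Sum.elim partialQ partialP b f) := fun b =>
    contDiff_flatDeriv hf (m := 1) (by norm_num) b
  have h1c : ∀ b, HasCompactSupport (Sum.elim partialQ partialP b f) := fun b =>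
    hasCompactSupport_flatDeriv hfd hfc b
  have h2c : ∀ a b, HasCompactSupport (Sum.elim partialQ partialP a (Sum.elim partialQ partialP b f)) := fun a b =>
    hasCompactSupport_flatDeriv ((h1 b).differentiable one_ne_zero) (h1c b) a
  have h2C : ∀ a b, Continuous (Sum.elim partialQ partialP a (Sum.elim partialQ partialP b f)) := fun a b =>
    continuous_flatDeriv (h1 b) one_ne_zero a
  have hρc : Continuous (gaussDensity S⁻¹ : PhaseSpace N → ℝ) := continuous_gaussDensity S⁻¹
  -- the matrix of Gaussian integrals of second derivatives
  set H : Fin N ⊕ Fin N → Fin N ⊕ Fin N → ℝ := fun a b =>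
    ∫ x, Sum.elim partialQ partialP a (Sum.elim partialQ partialP b f) x * gaussDensity S⁻¹ x with hH
  have hHsymm : ∀ a b, H a b = H b a := by
    intro a b
    simp only [hH]
    congr 1; funext x
    rw [flatDeriv_comm hf a b x]
  -- drift term
  have hdrift : ∀ a, ∫ x, (A *ᵥ flat x) a * Sum.elim partialQ partialP a f x * gaussDensity S⁻¹ x =
      ∑ b, (A * S) a b * H b a := by
    intro a
    have hint : ∀ c, Integrable fun x : PhaseSpace N =>
        flat x c * Sum.elim partialQ partialP a f x * gaussDensity S⁻¹ x := by
      intro c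
      refine Continuous.integrable_of_hasCompactSupport
        (((continuous_flat_apply c).mul (continuous_flatDeriv hf two_ne_zero a)).mul hρc) ?_
      exact ((h1c a).mul_left).mul_right
    calc ∫ x, (A *ᵥ flat x) a * Sum.elim partialQ partialP a f x * gaussDensity S⁻¹ x
        = ∫ x, ∑ c, A a c * (flat x c * Sum.elim partialQ partialP a f x * gaussDensity S⁻¹ x) := by
          congr 1; funext x
          simp only [mulVec, dotProduct, Finset.sum_mul]
          refine Finset.sum_congr rfl fun c _ => ?_
          ring
      _ = ∑ c, A a c * ∫ x, flat x c * Sum.elim partialQ partialP a f x * gaussDensity S⁻¹ x := by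
          rw [integral_finsetSum _ fun c _ => (hint c).const_mul _]
          congr 1; funext c
          rw [integral_const_mul]
      _ = ∑ c, A a c * ∑ b, S c b * H b a := by
          congr 1; funext c
          rw [integral_flat_mul_gaussDensity_eq_sum hS (h1 a) (h1c a) c]
      _ = ∑ b, (A * S) a b * H b a := by
          simp only [Matrix.mul_apply, Finset.mul_sum, Finset.sum_mul]
          rw [Finset.sum_comm]
          refine Finset.sum_congr rfl fun b _ => Finset.sum_congr rfl fun c _ => ?_
          ring
  -- integrability of the summands
  have hintA : ∀ a, Integrable fun x : PhaseSpace N =>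
      (A *ᵥ flat x) a * Sum.elim partialQ partialP a f x * gaussDensity S⁻¹ x := fun a =>
    Continuous.integrable_of_hasCompactSupport
      (((continuous_mulVec_flat_apply A a).mul (continuous_flatDeriv hf two_ne_zero a)).mul hρc)
      ((h1c a).mul_left).mul_right
  have hintD : ∀ a b, Integrable fun x : PhaseSpace N =>
      D a b * Sum.elim partialQ partialP a (Sum.elim partialQ partialP b f) x * gaussDensity S⁻¹ x := fun a b =>
    Continuous.integrable_of_hasCompactSupport ((continuous_const.mul (h2C a b)).mul hρc)
      ((h2c a b).mul_left).mul_right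
  -- assemble
  have hsplit : (fun x : PhaseSpace N => ((∑ a, (A *ᵥ flat x) a * Sum.elim partialQ partialP a f x) +
      (1 / 2) * ∑ a, ∑ b, D a b * Sum.elim partialQ partialP a (Sum.elim partialQ partialP b f) x) * gaussDensity S⁻¹ x) = fun x =>
      (∑ a, (A *ᵥ flat x) a * Sum.elim partialQ partialP a f x * gaussDensity S⁻¹ x) +
        (1 / 2) * ∑ a, ∑ b, D a b * Sum.elim partialQ partialP a (Sum.elim partialQ partialP b f) x * gaussDensity S⁻¹ x := by
    funext x
    simp only [add_mul, Finset.sum_mul, mul_assoc, Finset.mul_sum]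
  rw [hsplit, integral_add (integrable_finsetSum _ fun a _ => hintA a)
    ((integrable_finsetSum _ fun a _ => integrable_finsetSum _ fun b _ => hintD a b).const_mul _),
    integral_const_mul, integral_finsetSum _ fun a _ => hintA a,
    integral_finsetSum _ fun a _ => integrable_finsetSum _ fun b _ => hintD a b]
  simp_rw [integral_finsetSum _ fun b _ => hintD _ b, hdrift]
  have hD : ∀ a b, ∫ x, D a b * Sum.elim partialQ partialP a (Sum.elim partialQ partialP b f) x * gaussDensity S⁻¹ x =
      D a b * H a b := by
    intro a b
    simp only [hH, ← integral_const_mul]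
    congr 1; funext x; ring
  simp_rw [hD]
  -- the Lyapunov equation entrywise: `D a b = -(AS) a b - (AS) b a`
  have hlyap' : ∀ a b, D a b = -(A * S) a b - (A * S) b a := by
    intro a b
    have h := congrFun (congrFun hlyap a) b
    simp only [Matrix.add_apply, Matrix.zero_apply] at h
    have hSA : (S * Aᵀ) a b = (A * S) b a := by
      simp only [Matrix.mul_apply, transpose_apply]
      refine Finset.sum_congr rfl fun c _ => ?_
      rw [hST a c]; ring
    linarith
  simp_rw [hlyap']
  have e1 : ∑ a, ∑ b, (-(A * S) a b - (A * S) b a) * H a b =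
      -(∑ a, ∑ b, (A * S) a b * H b a) - ∑ a, ∑ b, (A * S) a b * H b a := by
    have : ∑ a, ∑ b, (-(A * S) a b - (A * S) b a) * H a b =
        -(∑ a, ∑ b, (A * S) a b * H a b) - ∑ a, ∑ b, (A * S) b a * H a b := by
      simp only [sub_mul, neg_mul, Finset.sum_sub_distrib, Finset.sum_neg_distrib]
    rw [this]
    congr 1
    · congr 1
      exact Finset.sum_congr rfl fun a _ => Finset.sum_congr rfl fun b _ => by rw [hHsymm a b]
    · rw [Finset.sum_comm]
  rw [e1]
  ring

/-! ### Normalised statement -/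

/-- **The Gaussian measure with Lyapunov covariance is weakly stationary** for the linear
Langevin generator `L_{A,D}`: if `S ≻ 0` solves `A S + S Aᵀ + D = 0` then
`∫ L_{A,D} f d(gaussMeasure S⁻¹) = 0` for `f ∈ C²_c` (`gaussMeasure S⁻¹ = Z⁻¹ e^{-½x♭ᵀS⁻¹x♭} dq dp`,
the centred Gaussian with covariance `S`, `LinearLangevinGaussianMeasure.lean`).
[cite: Dhar2008, §3.1] -/
theorem integral_ouGenerator_gaussMeasure {A D S : Matrix (Fin N ⊕ Fin N) (Fin N ⊕ Fin N) ℝ}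
    (hS : S.PosDef) (hlyap : A * S + S * Aᵀ + D = 0) {f : PhaseSpace N → ℝ}
    (hf : ContDiff ℝ 2 f) (hfc : HasCompactSupport f) :
    ∫ x, ((∑ a, (A *ᵥ flat x) a * Sum.elim partialQ partialP a f x) +
      (1 / 2) * ∑ a, ∑ b, D a b * Sum.elim partialQ partialP a (Sum.elim partialQ partialP b f) x) ∂(gaussMeasure S⁻¹) = 0 := by
  rw [integral_gaussMeasure, integral_ouGenerator_mul_gaussDensity hS hlyap hf hfc, mul_zero]

end Generic

section CL

variable {n : ℕ}

/-! ### The Casher–Lebowitz generator in matrix form -/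

/-- The phase-space coordinates of `DisorderedHarmonicChainSpectral.lean` are the flat
coordinates of `LinearLangevinGaussian.lean`: `phaseCoord a x = x♭_a`. [folklore] -/
theorem phaseCoord_eq_flat (a : Fin n ⊕ Fin n) (x : PhaseSpace n) : phaseCoord a x = flat x a := by
  rcases a with i | i <;> rfl

/-- Position rows of the drift: `(A x♭)_{q_i} = p_i / m_i`. [folklore] -/
theorem clDriftMatrix_mulVec_flat_inl (m : Fin n → ℝ) (lam : ℝ) (x : PhaseSpace n) (i : Fin n) :
    (clDriftMatrix m lam *ᵥ flat x) (Sum.inl i) = (m i)⁻¹ * x.2 i := by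
  simp only [flat, clDriftMatrix, fromBlocks_mulVec, Sum.elim_comp_inl, Sum.elim_comp_inr,
    zero_mulVec, zero_add, Sum.elim_inl, mulVec_diagonal]

/-- Momentum rows of the drift: `(A x♭)_{p_i} = -(Φ_D q)_i - λ E_i p_i`. [folklore] -/
theorem clDriftMatrix_mulVec_flat_inr (m : Fin n → ℝ) (lam : ℝ) (x : PhaseSpace n) (i : Fin n) :
    (clDriftMatrix m lam *ᵥ flat x) (Sum.inr i) =
      -(clForceMatrix n *ᵥ x.1) i - lam * bathMult n i * x.2 i := by
  simp only [flat, clDriftMatrix, fromBlocks_mulVec, Sum.elim_comp_inl, Sum.elim_comp_inr,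
    Sum.elim_inr, Pi.add_apply, neg_mulVec, Pi.neg_apply, frictionMatrix, mulVec_diagonal]
  ring

/-- **The Casher–Lebowitz generator is the linear Langevin generator** of the drift matrix
`clDriftMatrix m λ` and the noise matrix `clNoiseMatrix m λ T_L T_R`:
`clGenerator m λ T_L T_R f = ∑_a (A x♭)_a ∂♭_a f + ½ ∑ Σ_ab ∂♭_a ∂♭_b f` pointwise, for every `f`
(`dq_k = (p_k/m_k) dt`, `dp_k = -∂_{q_k}H dt + (δ_{k,1}+δ_{k,n})(-λ p_k dt + √(2λT_km_k) dW_k)`).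
[cite: AjankiHuveneers2011, §1.1 eq. (1.4)] -/
theorem clGenerator_eq_ouGenerator (m : Fin n → ℝ) (lam T_L T_R : ℝ) (f : PhaseSpace n → ℝ)
    (x : PhaseSpace n) :
    clGenerator m lam T_L T_R f x =
      ((∑ a, (clDriftMatrix m lam *ᵥ flat x) a * Sum.elim partialQ partialP a f x) +
        (1 / 2) * ∑ a, ∑ b, clNoiseMatrix m lam T_L T_R a b * Sum.elim partialQ partialP a (Sum.elim partialQ partialP b f) x) := by
  have hD11 : ∀ i j, clNoiseMatrix m lam T_L T_R (Sum.inl i) (Sum.inl j) = 0 := fun i j => by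
    simp [clNoiseMatrix]
  have hD12 : ∀ i j, clNoiseMatrix m lam T_L T_R (Sum.inl i) (Sum.inr j) = 0 := fun i j => by
    simp [clNoiseMatrix]
  have hD21 : ∀ i j, clNoiseMatrix m lam T_L T_R (Sum.inr i) (Sum.inl j) = 0 := fun i j => by
    simp [clNoiseMatrix]
  have hD22 : ∀ i j, clNoiseMatrix m lam T_L T_R (Sum.inr i) (Sum.inr j) =
      if i = j then 2 * lam * m i * bathTemp n T_L T_R i else 0 := fun i j => by
    simp [clNoiseMatrix, diagonal_apply]
  simp only [Fintype.sum_sum_type, clDriftMatrix_mulVec_flat_inl,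
    clDriftMatrix_mulVec_flat_inr, hD11, hD12, hD21, hD22, zero_mul, Finset.sum_const_zero,
    zero_add, ite_mul, Finset.sum_ite_eq, Finset.mem_univ, if_true, Sum.elim_inl, Sum.elim_inr, clGenerator, partialQ_clHamiltonian]
  simp only [Finset.mul_sum, ← Finset.sum_add_distrib]
  refine Finset.sum_congr rfl fun k _ => ?_
  simp only [bathMult, bathTemp]
  split_ifs <;> ring

end CL

end Literature.Barriers.AtomisticToContinuum.HeatConduction

namespace Literature.Barriers.AtomisticToContinuum

open Literature.MathematicalPhysics.KineticTheory.HeatConduction HeatConduction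

/-- **Discharge of (F1a): the Gaussian stationary state of the Casher–Lebowitz chain.** For every
`n`, positive masses, `λ > 0` and `T_L, T_R > 0`, the centred Gaussian probability measure on
phase space whose covariance is the solution `B = clCov m λ T_L T_R` of "`â·B̂ + B̂·âᵀ = D̂`"
("the steady state is given by the Gaussian distribution
`(2π)^{-N} Det[B̂]^{-1/2} e^{-½ qᵀB̂⁻¹q}`"), here `gaussMeasure B⁻¹`, is a weak steady state of
`clGenerator` with second moments `B`: `B ≻ 0` (`clCov_posDef`: Gibbs anchor, linearity in the
temperatures, controllability from the left bath), so the density is integrable and normalised;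
the generator of the chain is the Ornstein–Uhlenbeck generator of its drift and noise
matrices (`clGenerator_eq_ouGenerator`), whose Gaussian integral vanishes by the Lyapunov
equation `clCov_lyapunov` and Gaussian integration by parts (`integral_ouGenerator_gaussMeasure`);
the second moments are `∫ x♭_i x♭_j = B_ij` (`integral_flat_mul_flat_gaussMeasure`).
[cite: Dhar2008, §3.1] -/
theorem CasherLebowitz1971_steadyState_holds : CasherLebowitz1971_steadyState := by
  intro n m hm lam T_L T_R hlam hL hR
  have hB : (clCov m lam T_L T_R).PosDef := clCov_posDef hm hlam hL hR
  have hBi : (clCov m lam T_L T_R)⁻¹.PosDef := hB.inv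
  have hunit : IsUnit (clCov m lam T_L T_R).det := (isUnit_iff_isUnit_det _).mp hB.isUnit
  have hBB : clCov m lam T_L T_R * (clCov m lam T_L T_R)⁻¹ = 1 := mul_nonsing_inv _ hunit
  have hBT : (clCov m lam T_L T_R)ᵀ = clCov m lam T_L T_R := transpose_eq_of_posDef hB
  refine ⟨gaussMeasure (clCov m lam T_L T_R)⁻¹, ⟨isProbabilityMeasure_gaussMeasure hBi,
    fun f hf hfc => ?_, fun k => ?_⟩, fun i j => ?_⟩
  · exact (integral_congr_ae (ae_of_all _ fun x => clGenerator_eq_ouGenerator m lam T_L T_R f x)).trans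
      (integral_ouGenerator_gaussMeasure hB (clCov_lyapunov hm hlam T_L T_R)
        (hf.of_le (by norm_cast)) hfc)
  · have h := integrable_gaussMeasure (clCov m lam T_L T_R)⁻¹
      (integrable_flat_mul_flat_mul_gaussDensity hBi (Sum.inr k) (Sum.inr k))
    refine h.congr (ae_of_all _ fun x => ?_)
    simp [flat, sq]
  · simp_rw [phaseCoord_eq_flat]
    exact ⟨integrable_gaussMeasure (clCov m lam T_L T_R)⁻¹
        (integrable_flat_mul_flat_mul_gaussDensity hBi i j),
      integral_flat_mul_flat_gaussMeasure hBi hBB hBT i j⟩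

end Literature.Barriers.AtomisticToContinuum

end
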